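import Literature.IUT.HodgeArakelov.MonoThetaProjectiveProp16RefTF
import HarnessLib

/-!
# [IUTchII] Prop. 1.6 (i)/(ii): the tempered-side API of the reference predicates, PORTED to the print-faithful
# currency `RefIsEllipticTF` / `RefIsCoreTF` / `GenuineTF` (finding T1g11-F1 at layer L6; proof-only companion)

PROOF-ONLY companion (no `def`, no `structure`, no instance, no notation, no new named fact; nothing landed is edited)
of the abc-iut cell, seat abc-iut-w5-d031 (gen 15), for the DAG nodes **IUTchII:Prop1.6(i)** and **IUTchII:Prop1.6(ii)**
(layer L6, OUTSIDE the [IUTchIII] Cor. 3.12 cone); abc-iut-L6-lead «L6 ROWS #6» slice (d1) (§F v1.19eh (A), ruling M3 on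
abc-iut-L6-t7's impact census `HOME/staging/L6/L6-t7/gen8/T1G11-F1-L6-IMPACT.md`, rows 8 / 23 of its table (ii)); it sits
over abc-iut-L6-t7's slice (a) statement file `MonoThetaProjectiveProp16RefTF.lean` (the predicates
`EllipticCuspidalization.RefIsEllipticTF`, `CoreData.RefIsCoreTF`, the structures `EllipticCuspidalization.GenuineTF`,
`CoreData.GenuineTF`, the bridges `RefIsElliptic.toTF` / `Genuine.toTF` / `RefIsCore.toTF` / `CoreData.Genuine.toTF`,
`GenuineTF.transport`), imported BY NAME.

S. Mochizuki, *Inter-universal Teichmüller Theory II*, kurims manuscript (Dec. 2020), §1, Prop. 1.6 p. 31: (i)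
l. 16–33 "(Cores) … `Π ↦ {Π ⊆ Π_C(Π)}` … such that when `Π = Π^tp_{X̲̲_k}`, the inclusion `Π ⊆ Π_C(Π)` may be naturally
identified with the inclusion `Π^tp_{X̲̲_k} ⊆ Π^tp_{C_k}`"; (ii) l. 34–41 "(Elliptic Cuspidalizations) … `Π ↦ {Π_{U_N}(Π) ↠ Π}`
… such that when `Π = Π^tp_{X̲̲_k}`, the surjection `Π_{U_N}(Π) ↠ Π` may be naturally identified with a certain surjection —
i.e., “elliptic cuspidalization” — … [cf. [AbsTopII], Corollary 3.3, (iii)]" [claim: Mochizuki2012, status: disputed]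
(IUTchII §1 Prop 1.6, kurims p.31).  S. Mochizuki, *Topics in Absolute Anabelian Geometry II* [AbsTopII], Cor. 3.3
pp. 67–69 ((i) the `k'`-core; (iii)(c) "The decomposition groups of the closed points of `X` lying in the complement of
`U_X` may be obtained as the images via `Π_{U_X} ↠ Π` of the cuspidal decomposition groups of `Π_{U_X}`")
[cite: MochizukiAbsTopII2013, Cor 3.3 pp.67-69]; S. Mochizuki, *Semi-graphs of anabelioids* [SemiAnbd] §6 pp. 69–74
(the category `DLoc`: "the quotient of `H` by the closed normal subgroup generated by some collection of cuspidal
geometric decomposition groups") [cite: MochizukiSemiAnbd2006, §6 pp.69-74].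

## What is proved (the same proof terms as the frozen-currency companions, read through the (R0)/(R1) fields)

The clauses (R0)/(R1) of the TF predicates are VERBATIM those of abc-iut-w5-d030's `RefIsElliptic` (p437894) /
`RefIsCore` (p442307); only the record type of (R2)/(core) changed.  Hence every theorem of the proof-only companions
`MonoThetaProjectiveProp16EllipticRefProofs.lean` (p439497 + p440541) and `MonoThetaProjectiveProp16CoreRefProofs.lean`
(p442984) that reads only (R0)/(R1) — or re-exports the surviving (R2-TF)/(core-TF) clause — holds over the TF predicates
with the SAME proof:
* `RefIsEllipticTF.refHom_continuous`, `.isClosed_ker`, `.inertia_le_ker`, `.removed_not_cusp_image`, `.transport`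
  (stability under the output's functorial transport), `.range_aug_comp_refHom` (the composite augmentation
  `Π^tp_U ↠ Π^tp_X → G_{ℚ_p}` has image exactly `G_k`), `.exists_aug_refHom_eq`;
* `Genuine.toTF_transport` — the bridge commutes with functoriality (`rfl`); `GenuineTF.range_aug_comp_refHom`
  (bundled form);
* `RefIsCoreTF.continuous_refIncl`, `.refIncl_injective`, `.isOpen_range_refIncl`, `.inclRef_injective`;
  `CoreData.GenuineTF.inclRef_injective` (bundled form); `CoreData.Genuine.toTF_eC` (`rfl`).
(`RefIsEllipticTF.exists_level` and `RefIsCoreTF.exists_core_record` live in the statement file.)  At genuine `X̲̲_k`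
(free profinite `Δ̂` of rank `≥ 2`) these theorems are NO LONGER VACUOUS: the TF predicates are satisfiable there
(abc-iut-L6-d7's identity-TF witness, slice (b)), unlike the frozen ones (`Summit.ABC.IUTFork.refIsElliptic_false_of_isFreeProOn_deltaHat`,
abc-iut-L4-t17 p499351).

HONEST SCOPE: statements about the tree's typed predicates; nothing is asserted to be inhabited here; a re-point restores
SATISFIABILITY of OUR typed reference clauses at genuine `X`, not CONTENT (the content gate is the chain conjunct, slice
(c)); nothing here takes a side on [IUTchIII] Cor. 3.12; typed ≠ proved; nothing here asserts abc proved or refuted.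
-/

open Topology
open scoped Pointwise

universe u

namespace Literature.IUT.HodgeArakelov

open Literature.AnabelianGeometry.SemiGraphs (TemperedCurve)
open Literature.AnabelianGeometry.AbsoluteAnabelian (FundamentalExtension)

/-! ## Prop. 1.6 (ii): the API of `RefIsEllipticTF` -/

namespace EllipticCuspidalization

variable {S : ThetaSetting.{u}} {N : ℕ+} {P P' : TopGroup.{u}}

section Ref

variable {p : ℕ} [Fact p.Prime]

namespace RefIsEllipticTF

variable {K : EllipticCuspidalization S N P} {X U : TemperedCurve p} {eX : X.PiTemp ≃ₜ* S.PiX}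
  {eU : U.PiTemp ≃ₜ* K.PiURef}

/-- Under the TF predicate the tempered reading `Π^tp_U → Π^tp_X` of the reference surjection is continuous
((R1) `continuous_projRef` composed with the identifications).
[claim: Mochizuki2012, status: disputed] (IUTchII §1 Prop 1.6 (ii), kurims p.31) -/
theorem refHom_continuous (h : K.RefIsEllipticTF X U eX eU) : Continuous (K.refHom X U eX eU) :=
  eX.symm.continuous.comp (h.continuous_projRef.comp eU.continuous)

/-- Under the TF predicate the kernel of `Π^tp_U ↠ Π^tp_X` is a CLOSED normal subgroup (a topological closure — the
`DLoc` shape of [SemiAnbd] §6). [cite: MochizukiSemiAnbd2006, §6 p.73] -/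
theorem isClosed_ker (h : K.RefIsEllipticTF X U eX eU) : IsClosed ((K.refHom X U eX eU).ker : Set U.PiTemp) := by
  obtain ⟨R, -, hker, -⟩ := h.kernel_eq
  rw [hker]
  exact Subgroup.isClosed_topologicalClosure _

/-- Under the TF predicate the inertia groups of the removed cusps die in `Π^tp_X` (they lie in the kernel).
[cite: MochizukiSemiAnbd2006, §6 p.73] -/
theorem inertia_le_ker (h : K.RefIsEllipticTF X U eX eU) :
    ∃ R : Set U.Pt, (∀ x ∈ R, U.IsCusp x) ∧ ∀ x ∈ R, U.inertia x ≤ (K.refHom X U eX eU).ker := by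
  obtain ⟨R, hR, hker, -⟩ := h.kernel_eq
  refine ⟨R, hR, fun x hx g hg => ?_⟩
  rw [hker]
  refine Subgroup.le_topologicalClosure _ (Subgroup.subset_normalClosure ?_)
  exact Set.mem_biUnion hx hg

/-- [AbsTopII] Cor. 3.3 (iii)(c) under the TF predicate: every removed cusp of `U` lies over a NON-cuspidal closed point
of `X` whose decomposition group class contains the image of the cusp's decomposition group.
[cite: MochizukiAbsTopII2013, Cor 3.3 (iii) p.68] -/
theorem removed_not_cusp_image (h : K.RefIsEllipticTF X U eX eU) :
    ∃ R : Set U.Pt, (K.refHom X U eX eU).ker =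
        (Subgroup.normalClosure (⋃ x ∈ R, (U.inertia x : Set U.PiTemp))).topologicalClosure ∧
      ∀ x ∈ R, ∃ y : X.Pt, ¬ X.IsCusp y ∧ X.IsDecompositionGroup ((U.decomp x).map (K.refHom X U eX eU)) := by
  obtain ⟨R, -, hker, hc⟩ := h.kernel_eq
  refine ⟨R, hker, fun x hx => ?_⟩
  obtain ⟨y, hy, γ, hγ⟩ := hc x hx
  exact ⟨y, hy, y, γ, hγ⟩

/-- **TRANSPORT.** The TF predicate is stable under the output's functorial transport along `P ≃ₜ* P'` (the reference
datum and `projRef` do not move, `EllipticCuspidalization.transport_projRef`).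
[claim: Mochizuki2012, status: disputed] (IUTchII §1 Prop 1.6 (ii), kurims p.31) -/
theorem transport (h : K.RefIsEllipticTF X U eX eU) (f : P ≃ₜ* P') :
    (K.transport f).RefIsEllipticTF X U eX eU where
  deltaTemp_eq := h.deltaTemp_eq
  K_eq := h.K_eq
  continuous_projRef := h.continuous_projRef
  aug_comp := h.aug_comp
  kernel_eq := h.kernel_eq
  elliptic := h.elliptic

/-- **The composite augmentation** (the bracket of Prop. 1.6 (ii): "so the augmentation `Π ↠ Π/Δ` determines, by
composition, an augmentation `Π_{U_N}(Π) ↠ Π/Δ`"): under the TF predicate, `Π^tp_U ↠ Π^tp_X → G_{ℚ_p}` has image EXACTLY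
`G_k` ((R1) `aug_comp` + the [SemiAnbd] §6 axiom `range_aug` of `U` + `K_eq`).
[claim: Mochizuki2012, status: disputed] (IUTchII §1 Prop 1.6 (ii), kurims p.31) -/
theorem range_aug_comp_refHom (h : K.RefIsEllipticTF X U eX eU) :
    (X.aug.toMonoidHom.comp (K.refHom X U eX eU)).range = X.GK := by
  have hU : U.aug.toMonoidHom.range = U.K.fixingSubgroup := U.range_aug
  ext g
  constructor
  · rintro ⟨y, rfl⟩
    have hy : U.aug y ∈ U.aug.toMonoidHom.range := ⟨y, rfl⟩
    rw [hU, h.K_eq] at hy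
    simpa [TemperedCurve.GK, h.aug_comp y] using hy
  · intro hg
    have hg' : g ∈ U.aug.toMonoidHom.range := by
      rw [hU, h.K_eq]
      exact hg
    obtain ⟨y, hy⟩ := hg'
    exact ⟨y, by simpa [h.aug_comp y] using hy⟩

/-- Hence the composite augmentation `Π^tp_U → G_k` is SURJECTIVE onto `G_k`: every element of `G_k` lifts to
`Π^tp_{U_N}` under the TF predicate. [claim: Mochizuki2012, status: disputed] (IUTchII §1 Prop 1.6 (ii), kurims p.31) -/
theorem exists_aug_refHom_eq (h : K.RefIsEllipticTF X U eX eU) {g : Literature.AnabelianGeometry.SemiGraphs.GQp p}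
    (hg : g ∈ X.GK) : ∃ y : U.PiTemp, X.aug (K.refHom X U eX eU y) = g := by
  have : g ∈ (X.aug.toMonoidHom.comp (K.refHom X U eX eU)).range := by rw [h.range_aug_comp_refHom]; exact hg
  obtain ⟨y, hy⟩ := this
  exact ⟨y, hy⟩

end RefIsEllipticTF

end Ref

/-! ## Prop. 1.6 (ii): the bundled genuine output in the TF currency -/

variable {p : ℕ} [Fact p.Prime] {X U : TemperedCurve p} {eX : X.PiTemp ≃ₜ* S.PiX}

/-- **The bridge commutes with functoriality**: transporting a frozen-currency genuine output along `f : P ≃ₜ* P'` and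
then passing to the TF currency is the same as passing to the TF currency and transporting there (same underlying
output `K.transport f`, same `eU`; the predicates are `Prop`s). [claim: Mochizuki2012, status: disputed] (IUTchII §1 Prop 1.6 (ii), kurims p.31) -/
theorem Genuine.toTF_transport (G : EllipticCuspidalization.Genuine S N P X U eX) (f : P ≃ₜ* P') :
    (G.transport f).toTF = G.toTF.transport f := rfl

/-- For the bundled TF genuine output the composite augmentation `Π^tp_U ↠ Π^tp_X → G_{ℚ_p}` has image exactly `G_k`.
[claim: Mochizuki2012, status: disputed] (IUTchII §1 Prop 1.6 (ii), kurims p.31) -/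
theorem GenuineTF.range_aug_comp_refHom (G : EllipticCuspidalization.GenuineTF S N P X U eX) :
    (X.aug.toMonoidHom.comp (G.refHom X U eX G.eU)).range = X.GK :=
  G.refIsEllipticTF.range_aug_comp_refHom

end EllipticCuspidalization

/-! ## Prop. 1.6 (i): the API of `RefIsCoreTF` -/

namespace CoreData

variable {S : ThetaSetting.{u}} {P : TopGroup.{u}} {p : ℕ} [Fact p.Prime] {Cd : CoreData S P}
  {X C : TemperedCurve p} {eX : X.PiTemp ≃ₜ* S.PiX} {eC : C.PiTemp ≃ₜ* Cd.PiCRef}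

namespace RefIsCoreTF

/-- Under the TF predicate the inclusion `Π^tp_X → Π^tp_C` is continuous ((R1) open embedding).
[claim: Mochizuki2012, status: disputed] (IUTchII §1 Prop 1.6 (i), kurims p.31) -/
theorem continuous_refIncl (h : Cd.RefIsCoreTF X C eX eC) : Continuous (Cd.refIncl X C eX eC) :=
  h.isOpenEmbedding_refIncl.continuous

/-- Under the TF predicate the inclusion `Π^tp_X → Π^tp_C` is injective ("`Π ⊆ Π_C(Π)`").
[claim: Mochizuki2012, status: disputed] (IUTchII §1 Prop 1.6 (i), kurims p.31) -/
theorem refIncl_injective (h : Cd.RefIsCoreTF X C eX eC) : Function.Injective (Cd.refIncl X C eX eC) :=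
  h.isOpenEmbedding_refIncl.injective

/-- Under the TF predicate `Π^tp_{X̲̲_k}` is an OPEN subgroup of `Π^tp_{C_k}` (a finite étale covering `X̲̲_k → C_k`).
[cite: MochizukiSemiAnbd2006, §6 p.73] -/
theorem isOpen_range_refIncl (h : Cd.RefIsCoreTF X C eX eC) : IsOpen (Set.range (Cd.refIncl X C eX eC)) :=
  h.isOpenEmbedding_refIncl.isOpen_range

/-- Under the TF predicate the frozen output's reference inclusion `inclRef : Π^tp_{X̲̲_k} → Π^tp_{C_k}` is itself
injective (it differs from `refIncl` by isomorphisms). [claim: Mochizuki2012, status: disputed] (IUTchII §1 Prop 1.6 (i), kurims p.31) -/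
theorem inclRef_injective (h : Cd.RefIsCoreTF X C eX eC) : Function.Injective Cd.inclRef := by
  intro a b hab
  have key : Cd.refIncl X C eX eC (eX.symm a) = Cd.refIncl X C eX eC (eX.symm b) := by
    rw [refIncl_apply, refIncl_apply, ContinuousMulEquiv.apply_symm_apply, ContinuousMulEquiv.apply_symm_apply, hab]
  simpa using congrArg eX (h.refIncl_injective key)

end RefIsCoreTF

/-- For the bundled TF genuine core output, the reference inclusion is injective.
[claim: Mochizuki2012, status: disputed] (IUTchII §1 Prop 1.6 (i), kurims p.31) -/
theorem GenuineTF.inclRef_injective {X C : TemperedCurve p} {eX : X.PiTemp ≃ₜ* S.PiX}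
    (G : CoreData.GenuineTF S P X C eX) : Function.Injective G.inclRef :=
  G.refIsCoreTF.inclRef_injective

/-- `CoreData.Genuine.toTF` keeps the identification `eC` of the reference side with `Π^tp_{C_k}`.
[claim: Mochizuki2012, status: disputed] (IUTchII §1 Prop 1.6 (i), kurims p.31) -/
theorem Genuine.toTF_eC {X C : TemperedCurve p} {eX : X.PiTemp ≃ₜ* S.PiX} (G : CoreData.Genuine S P X C eX) :
    G.toTF.eC = G.eC := rfl

end CoreData

end Literature.IUT.HodgeArakelov
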